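import Summits.AtomisticToContinuum.HydrodynamicLimit.Theses.AntiMazurCoboundaries
import Literature.MathematicalPhysics.KineticTheory.HardSphereEulerProofs
import Summits.AtomisticToContinuum.HydrodynamicLimit.Theorems.BoltzmannGreenKubo.Negative.TimeAverage

/-!
# The window second moment is the Fejér average of the stationary autocorrelation
# (sub-stub `stub_windowFejer`, W6, of the line `cutoff-compactness-net`)

Registered sub-stub `stub_windowFejer` of the crux `AntiMazurCoboundaries.ShearStressHalfDrude`
(stmt-AtomisticToContinuum-14136): for the homogeneous Gibbs law `G_N = localGibbsLaw σ a u₀ θ N Φ`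
(`σ ≤ 1/2`, `0 < a`, `0 < θ`), every hard-sphere flow `Φ`, every bounded measurable observable `F` and every
window `h > 0`,
`∫ (h⁻¹ ∫₀ʰ F(Φ_s z) ds)² dG_N = 2 h⁻² ∫₀ʰ (h − u) C(u) du`, `C(u) = ∫ F(z) F(Φ_u z) dG_N`.

The dynamical half is proved here for an ARBITRARY finite law `μ` on phase space carried by the good set
(`μ Φ.goodᶜ = 0`) and invariant under every `Φ_t` (`integral_sq_window_eq_double_of_invariant`,
`integral_sq_window_eq_fejer_of_invariant`): Bochner linearity for the square, Fubini twice on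
`μ ⊗ [0,h] ⊗ [0,h]` (bounded integrand, jointly measurable modification `flowMod` of the flow,
`BoltzmannGreenKubo/Negative/JointMeasurability`), and two-time stationarity
`∫ F(Φ_r z) F(Φ_{r'} z) dμ = C(r' − r)`, `C` even (group property on the good set + invariance), and the
triangle reduction `∫₀ʰ∫₀ʰ C(r' − r) = 2∫₀ʰ (h − u) C(u) du` for an even bounded measurable kernel
(`double_integral_sub_eq_of_even`; same route as `BoltzmannGreenKubo/Negative/WindowCovariance`, which treats
`a = θ = 1`, `u₀ = 0`). The stub instantiates `μ = G_N` (`measurePreserving_flow_localGibbsLaw`,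
`localGibbsLaw_compl_good`, `isProbabilityMeasure_localGibbsLaw`).
-/

noncomputable section

namespace Summit.AtomisticToContinuum.HydrodynamicLimit.Theorems

open MeasureTheory ProbabilityTheory Filter Set
open scoped ENNReal InnerProductSpace BigOperators
open Literature.Analysis.FluidPDE Literature.MathematicalPhysics.KineticTheory
open BoltzmannGreenKuboOrthMomentum

namespace ShearStressHalfDrudeWindowFejer

variable {N : ℕ} {ε : ℝ}

/-! ## Two-time stationarity under an invariant law carried by the good set -/

/-- **Two-time stationarity**: if `μ` is carried by the good set and invariant under the flow, then
`∫ X(Φ_r z) X(Φ_{r'} z) dμ = ∫ X(z) X(Φ_{r' − r} z) dμ` for all real `r, r'` (group property on the good set,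
then invariance of `μ` under `Φ_r`). [folklore] -/
theorem integral_mul_flow_flow_eq_sub (Φ : HardSphereFlow (Torus.geometry (Fin 3)) ε N)
    {μ : Measure (Config N (Fin 3) T3)} (hμ : μ Φ.goodᶜ = 0)
    (hmp : ∀ t, MeasurePreserving (Φ.flow t) μ μ)
    {X : Config N (Fin 3) T3 → ℝ} (hX : Measurable X) (r r' : ℝ) :
    ∫ z, X (Φ.flow r z) * X (Φ.flow r' z) ∂μ = ∫ z, X z * X (Φ.flow (r' - r) z) ∂μ := by
  have hgood : ∀ᵐ z ∂μ, z ∈ Φ.good := mem_ae_iff.2 hμ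
  have hae : (fun z => X (Φ.flow r z) * X (Φ.flow r' z)) =ᵐ[μ]
      fun z => (fun w => X w * X (Φ.flow (r' - r) w)) (Φ.flow r z) := by
    filter_upwards [hgood] with z hz
    have key : Φ.flow r' z = Φ.flow (r' - r) (Φ.flow r z) := by
      have := Φ.flow_add (r' - r) r z hz
      rwa [sub_add_cancel] at this
    simp only [key]
  rw [integral_congr_ae hae]
  have hF : AEStronglyMeasurable (fun w => X w * X (Φ.flow (r' - r) w)) (μ.map (Φ.flow r)) :=
    (hX.mul (hX.comp (Φ.measurable_flow _))).aestronglyMeasurable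
  have h := integral_map (Φ.measurable_flow r).aemeasurable hF
  rw [(hmp r).map_eq] at h
  exact h.symm

/-- **The stationary autocorrelation is even**: `C(−t) = C(t)` under an invariant law carried by the good
set. [folklore] -/
theorem integral_mul_flow_neg_eq (Φ : HardSphereFlow (Torus.geometry (Fin 3)) ε N)
    {μ : Measure (Config N (Fin 3) T3)} (hμ : μ Φ.goodᶜ = 0)
    (hmp : ∀ t, MeasurePreserving (Φ.flow t) μ μ)
    {X : Config N (Fin 3) T3 → ℝ} (hX : Measurable X) (t : ℝ) :
    ∫ z, X z * X (Φ.flow (-t) z) ∂μ = ∫ z, X z * X (Φ.flow t z) ∂μ := by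
  have h1 := integral_mul_flow_flow_eq_sub Φ hμ hmp hX t 0
  have h2 := integral_mul_flow_flow_eq_sub Φ hμ hmp hX 0 t
  rw [zero_sub] at h1
  rw [sub_zero] at h2
  rw [← h1, ← h2]
  simp_rw [mul_comm (X (Φ.flow t _))]

/-! ## Joint measurability of the two-time integrand -/

/-- A jointly measurable modification of the two-time integrand `((z, r), r') ↦ X(Φ_r z) X(Φ_{r'} z)` on
`μ ⊗ ν ⊗ ν'`, for `μ` carried by the good set. [folklore] -/
theorem aestronglyMeasurable_twoTime_triple (Φ : HardSphereFlow (Torus.geometry (Fin 3)) ε N)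
    {μ : Measure (Config N (Fin 3) T3)} [SFinite μ] (hμ : μ Φ.goodᶜ = 0)
    {X : Config N (Fin 3) T3 → ℝ} (hX : Measurable X) (ν ν' : Measure ℝ) [SFinite ν] [SFinite ν'] :
    AEStronglyMeasurable
      (fun p : (Config N (Fin 3) T3 × ℝ) × ℝ => X (Φ.flow p.1.2 p.1.1) * X (Φ.flow p.2 p.1.1))
      ((μ.prod ν).prod ν') := by
  have hM : Measurable fun p : (Config N (Fin 3) T3 × ℝ) × ℝ =>
      X (flowMod Φ (p.1.2, p.1.1)) * X (flowMod Φ (p.2, p.1.1)) :=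
    (hX.comp ((measurable_flowMod Φ).comp (measurable_fst.snd.prodMk measurable_fst.fst))).mul
      (hX.comp ((measurable_flowMod Φ).comp (measurable_snd.prodMk measurable_fst.fst)))
  refine ⟨_, hM.stronglyMeasurable, ?_⟩
  have hnull : ((μ.prod ν).prod ν') ((Φ.goodᶜ ×ˢ (Set.univ : Set ℝ)) ×ˢ (Set.univ : Set ℝ)) = 0 := by
    rw [Measure.prod_prod, Measure.prod_prod, hμ, zero_mul, zero_mul]
  have hae : ∀ᵐ p ∂((μ.prod ν).prod ν'), p.1.1 ∈ Φ.good := by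
    rw [ae_iff]
    refine measure_mono_null (fun p hp => ?_) hnull
    exact ⟨⟨hp, Set.mem_univ _⟩, Set.mem_univ _⟩
  filter_upwards [hae] with p hp
  simp only [flowMod_of_mem Φ hp]

/-- The two-time integrand with one time frozen is a.e.-strongly measurable on `μ ⊗ ν`. [folklore] -/
theorem aestronglyMeasurable_twoTime_slice (Φ : HardSphereFlow (Torus.geometry (Fin 3)) ε N)
    {μ : Measure (Config N (Fin 3) T3)} [SFinite μ] (hμ : μ Φ.goodᶜ = 0)
    {X : Config N (Fin 3) T3 → ℝ} (hX : Measurable X) (r : ℝ) (ν : Measure ℝ) [SFinite ν] :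
    AEStronglyMeasurable
      (fun q : Config N (Fin 3) T3 × ℝ => X (Φ.flow r q.1) * X (Φ.flow q.2 q.1)) (μ.prod ν) := by
  have hM : Measurable fun q : Config N (Fin 3) T3 × ℝ =>
      X (flowMod Φ (r, q.1)) * X (flowMod Φ (q.2, q.1)) :=
    (hX.comp ((measurable_flowMod Φ).comp (measurable_const.prodMk measurable_fst))).mul
      (hX.comp ((measurable_flowMod Φ).comp (measurable_snd.prodMk measurable_fst)))
  refine ⟨_, hM.stronglyMeasurable, ?_⟩
  have hnull : (μ.prod ν) (Φ.goodᶜ ×ˢ (Set.univ : Set ℝ)) = 0 := by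
    rw [Measure.prod_prod, hμ, zero_mul]
  have hae : ∀ᵐ q ∂(μ.prod ν), q.1 ∈ Φ.good := by
    rw [ae_iff]
    refine measure_mono_null (fun q hq => ?_) hnull
    exact ⟨hq, Set.mem_univ _⟩
  filter_upwards [hae] with q hq
  simp only [flowMod_of_mem Φ hq]

/-- `u ↦ C(u) = ∫ X(z) X(Φ_u z) dμ` is measurable (Bochner integral of a jointly measurable modification).
[folklore] -/
theorem measurable_integral_mul_flow (Φ : HardSphereFlow (Torus.geometry (Fin 3)) ε N)
    {μ : Measure (Config N (Fin 3) T3)} [SFinite μ] (hμ : μ Φ.goodᶜ = 0)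
    {X : Config N (Fin 3) T3 → ℝ} (hX : Measurable X) :
    Measurable fun t => ∫ z, X z * X (Φ.flow t z) ∂μ := by
  have hM : Measurable fun p : ℝ × Config N (Fin 3) T3 => X p.2 * X (flowMod Φ p) :=
    (hX.comp measurable_snd).mul (hX.comp (measurable_flowMod Φ))
  have hS : StronglyMeasurable fun t => ∫ z, X z * X (flowMod Φ (t, z)) ∂μ :=
    hM.stronglyMeasurable.integral_prod_right'
  have heq : (fun t => ∫ z, X z * X (Φ.flow t z) ∂μ) = fun t => ∫ z, X z * X (flowMod Φ (t, z)) ∂μ := by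
    funext t
    refine integral_congr_ae ?_
    filter_upwards [(mem_ae_iff.2 hμ : ∀ᵐ z ∂μ, z ∈ Φ.good)] with z hz
    rw [flowMod_of_mem Φ hz]
  rw [heq]
  exact hS.measurable

/-- `|C(u)| ≤ K² · μ(univ)` for `|X| ≤ K` and a finite law. [folklore] -/
theorem abs_integral_mul_flow_le (Φ : HardSphereFlow (Torus.geometry (Fin 3)) ε N)
    (μ : Measure (Config N (Fin 3) T3)) [IsFiniteMeasure μ]
    {X : Config N (Fin 3) T3 → ℝ} {K : ℝ} (hXb : ∀ z, |X z| ≤ K) (t : ℝ) :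
    |∫ z, X z * X (Φ.flow t z) ∂μ| ≤ K * K * μ.real univ := by
  have hK : 0 ≤ K := (abs_nonneg _).trans (hXb (Φ.flow 0 (fun _ => (0, 0))))
  have h := norm_integral_le_of_norm_le_const (μ := μ) (C := K * K)
    (f := fun z => X z * X (Φ.flow t z))
    (Eventually.of_forall fun z => by
      rw [Real.norm_eq_abs, abs_mul]
      exact mul_le_mul (hXb _) (hXb _) (abs_nonneg _) hK)
  rwa [Real.norm_eq_abs] at h

/-! ## The triangle reduction for an even kernel (pure real analysis) -/

/-- **Triangle reduction for an even bounded measurable kernel**: for `f` measurable, bounded and even and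
`h ≥ 0`, `∫₀ʰ ∫₀ʰ f(r' − r) dr' dr = 2 ∫₀ʰ (h − t) f(t) dt` (split the inner integral at `r' = r`, reflect the
lower piece by evenness, then Fubini on the triangle `{0 ≤ t ≤ u ≤ h}`). [folklore] -/
theorem double_integral_sub_eq_of_even {f : ℝ → ℝ} (hf : Measurable f) {M : ℝ} (hb : ∀ t, |f t| ≤ M)
    (heven : ∀ t, f (-t) = f t) {h : ℝ} (hh : 0 ≤ h) :
    ∫ r in (0 : ℝ)..h, ∫ r' in (0 : ℝ)..h, f (r' - r) = 2 * ∫ t in (0 : ℝ)..h, (h - t) * f t := by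
  have hii : ∀ a b : ℝ, IntervalIntegrable f volume a b := fun a b =>
    (intervalIntegrable_const (c := M)).mono_fun hf.aestronglyMeasurable
      (ae_of_all _ fun r => by simpa [Real.norm_eq_abs] using (hb r).trans (le_abs_self M))
  -- the primitive `P u = ∫₀ᵘ f` and the inner split `∫₀ʰ f(r' − r) dr' = P r + P (h − r)`
  have hsplit : ∀ r ∈ uIcc (0 : ℝ) h, ∫ r' in (0 : ℝ)..h, f (r' - r) =
      (∫ t in (0 : ℝ)..r, f t) + ∫ t in (0 : ℝ)..(h - r), f t := by
    intro r _
    rw [intervalIntegral.integral_comp_sub_right (fun x => f x) r, zero_sub,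
      ← intervalIntegral.integral_add_adjacent_intervals (hii (-r) 0) (hii 0 (h - r))]
    congr 1
    have hrefl : ∫ t in (0 : ℝ)..r, f (-t) = ∫ t in (-r)..0, f t := by
      rw [intervalIntegral.integral_comp_neg (fun x => f x), neg_zero]
    rw [← hrefl]
    simp only [heven]
  have hPc : Continuous fun u => ∫ t in (0 : ℝ)..u, f t := intervalIntegral.continuous_primitive hii 0
  have hPc' : Continuous fun r => ∫ t in (0 : ℝ)..(h - r), f t :=
    hPc.comp (continuous_const.sub continuous_id)
  rw [intervalIntegral.integral_congr hsplit,
    intervalIntegral.integral_add (hPc.intervalIntegrable 0 h) (hPc'.intervalIntegrable 0 h),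
    intervalIntegral.integral_comp_sub_left (fun u => ∫ t in (0 : ℝ)..u, f t) h, sub_self, sub_zero,
    ← two_mul]
  congr 1
  -- Fubini on the triangle: `∫₀ʰ P u du = ∫₀ʰ (h − t) f t dt`
  set ν : Measure ℝ := volume.restrict (Ioc (0 : ℝ) h) with hν
  haveI : IsFiniteMeasure ν := by
    rw [hν]
    exact ⟨by simp [Real.volume_Ioc]⟩
  rw [intervalIntegral.integral_of_le hh, intervalIntegral.integral_of_le hh]
  have hL : ∫ u in Ioc (0 : ℝ) h, (∫ t in (0 : ℝ)..u, f t) =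
      ∫ u in Ioc (0 : ℝ) h, ∫ t in Ioc (0 : ℝ) h, (Iic u).indicator f t := by
    refine setIntegral_congr_fun measurableSet_Ioc fun u hu => ?_
    have hset : Ioc (0 : ℝ) h ∩ Iic u = Ioc 0 u := by
      ext t
      simp only [Set.mem_Ioc, Set.mem_inter_iff, Set.mem_Iic]
      exact ⟨fun ⟨⟨h1, _⟩, h3⟩ => ⟨h1, h3⟩, fun ⟨h1, h2⟩ => ⟨⟨h1, h2.trans hu.2⟩, h2⟩⟩
    rw [intervalIntegral.integral_of_le hu.1.le, setIntegral_indicator measurableSet_Iic, hset]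
  rw [hL]
  have hint : Integrable (Function.uncurry fun u t : ℝ => (Iic u).indicator f t) (ν.prod ν) := by
    have he : (Function.uncurry fun u t : ℝ => (Iic u).indicator f t) =
        {p : ℝ × ℝ | p.2 ≤ p.1}.indicator fun p => f p.2 := by
      funext p
      simp only [Function.uncurry, Set.indicator, Set.mem_Iic, Set.mem_setOf_eq]
    rw [he]
    refine (integrable_const M).mono'
      ((hf.comp measurable_snd).indicator
        (measurableSet_le measurable_snd measurable_fst)).aestronglyMeasurable
      (Eventually.of_forall fun p => ?_)
    refine (norm_indicator_le_norm_self _ _).trans ?_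
    rw [Real.norm_eq_abs]
    exact hb _
  rw [integral_integral_swap hint]
  refine setIntegral_congr_fun measurableSet_Ioc fun t ht => ?_
  have he : (fun u : ℝ => (Iic u).indicator f t) = fun u => (Ici t).indicator (fun _ => f t) u := by
    funext u
    simp only [Set.indicator, Set.mem_Iic, Set.mem_Ici]
  rw [he, setIntegral_indicator measurableSet_Ici, setIntegral_const]
  have hset : Ioc (0 : ℝ) h ∩ Ici t = Icc t h := by
    ext u
    simp only [Set.mem_inter_iff, Set.mem_Ioc, Set.mem_Ici, Set.mem_Icc]
    exact ⟨fun ⟨⟨_, h2⟩, h3⟩ => ⟨h3, h2⟩, fun ⟨h3, h2⟩ => ⟨⟨ht.1.trans_le h3, h2⟩, h3⟩⟩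
  rw [hset, Measure.real, Real.volume_Icc, ENNReal.toReal_ofReal (by linarith [ht.2]), smul_eq_mul]

/-! ## The window second moment as a double / single time integral -/

/-- **Window second moment, double-integral form**: for a finite law `μ` carried by the good set and invariant
under the flow, a bounded measurable `X` and `h ≥ 0`,
`∫ (∫₀ʰ X(Φ_r z) dr)² dμ = ∫₀ʰ ∫₀ʰ C(r' − r) dr' dr` with `C(t) = ∫ X(z) X(Φ_t z) dμ`. [folklore] -/
theorem integral_sq_window_eq_double_of_invariant (Φ : HardSphereFlow (Torus.geometry (Fin 3)) ε N)
    {μ : Measure (Config N (Fin 3) T3)} [IsFiniteMeasure μ] (hμ : μ Φ.goodᶜ = 0)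
    (hmp : ∀ t, MeasurePreserving (Φ.flow t) μ μ)
    {X : Config N (Fin 3) T3 → ℝ} (hX : Measurable X) {K : ℝ} (hXb : ∀ z, |X z| ≤ K)
    {h : ℝ} (hh : 0 ≤ h) :
    ∫ z, (∫ r in (0 : ℝ)..h, X (Φ.flow r z)) ^ 2 ∂μ =
      ∫ r in (0 : ℝ)..h, ∫ r' in (0 : ℝ)..h, ∫ z, X z * X (Φ.flow (r' - r) z) ∂μ := by
  set ν : Measure ℝ := volume.restrict (Ioc (0 : ℝ) h) with hν
  haveI : IsFiniteMeasure ν := by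
    rw [hν]
    exact ⟨by simp [Real.volume_Ioc]⟩
  have hK : 0 ≤ K := (abs_nonneg _).trans (hXb (Φ.flow 0 (fun _ => (0, 0))))
  -- the bounded, a.e.-measurable two-time integrand on the triple product
  have hbd : ∀ p : (Config N (Fin 3) T3 × ℝ) × ℝ,
      ‖X (Φ.flow p.1.2 p.1.1) * X (Φ.flow p.2 p.1.1)‖ ≤ K * K := by
    intro p
    rw [Real.norm_eq_abs, abs_mul]
    exact mul_le_mul (hXb _) (hXb _) (abs_nonneg _) hK
  have hI3 : Integrable
      (fun p : (Config N (Fin 3) T3 × ℝ) × ℝ => X (Φ.flow p.1.2 p.1.1) * X (Φ.flow p.2 p.1.1))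
      ((μ.prod ν).prod ν) :=
    (integrable_const (K * K)).mono' (aestronglyMeasurable_twoTime_triple Φ hμ hX ν ν)
      (Eventually.of_forall hbd)
  have hI2 : ∀ r : ℝ, Integrable
      (fun q : Config N (Fin 3) T3 × ℝ => X (Φ.flow r q.1) * X (Φ.flow q.2 q.1)) (μ.prod ν) := fun r =>
    (integrable_const (K * K)).mono' (aestronglyMeasurable_twoTime_slice Φ hμ hX r ν)
      (Eventually.of_forall fun q => by
        rw [Real.norm_eq_abs, abs_mul]
        exact mul_le_mul (hXb _) (hXb _) (abs_nonneg _) hK)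
  -- step 1: square → double time integral, pointwise in z
  have h1 : ∀ z, (∫ r in (0 : ℝ)..h, X (Φ.flow r z)) ^ 2 =
      ∫ r in (0 : ℝ)..h, ∫ r' in (0 : ℝ)..h, X (Φ.flow r z) * X (Φ.flow r' z) := fun z => by
    rw [sq, ← intervalIntegral.integral_mul_const]
    refine intervalIntegral.integral_congr fun r _ => ?_
    exact (intervalIntegral.integral_const_mul (X (Φ.flow r z)) (fun r' => X (Φ.flow r' z))).symm
  simp_rw [h1]
  simp only [intervalIntegral.integral_of_le hh]
  -- step 2: swap `∫ dμ` with the outer `∫ dr`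
  have hswap1 : ∫ z, ∫ r, ∫ r', X (Φ.flow r z) * X (Φ.flow r' z) ∂ν ∂ν ∂μ =
      ∫ r, ∫ z, ∫ r', X (Φ.flow r z) * X (Φ.flow r' z) ∂ν ∂μ ∂ν :=
    integral_integral_swap hI3.integral_prod_left
  rw [hswap1]
  -- step 3: swap `∫ dμ` with the inner `∫ dr'`, for each `r`, then stationarity pointwise
  refine integral_congr_ae (Eventually.of_forall fun r => ?_)
  have hswap2 : ∫ z, ∫ r', X (Φ.flow r z) * X (Φ.flow r' z) ∂ν ∂μ =
      ∫ r', ∫ z, X (Φ.flow r z) * X (Φ.flow r' z) ∂μ ∂ν :=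
    integral_integral_swap (hI2 r)
  simp only
  rw [hswap2]
  refine integral_congr_ae (Eventually.of_forall fun r' => ?_)
  exact integral_mul_flow_flow_eq_sub Φ hμ hmp hX r r'

/-- **Window second moment, Fejér form**: for a finite law `μ` carried by the good set and invariant under the
flow, a bounded measurable `X` and `h ≥ 0`,
`∫ (∫₀ʰ X(Φ_r z) dr)² dμ = 2 ∫₀ʰ (h − u) C(u) du`, `C(u) = ∫ X(z) X(Φ_u z) dμ`. [folklore] -/
theorem integral_sq_window_eq_fejer_of_invariant (Φ : HardSphereFlow (Torus.geometry (Fin 3)) ε N)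
    {μ : Measure (Config N (Fin 3) T3)} [IsFiniteMeasure μ] (hμ : μ Φ.goodᶜ = 0)
    (hmp : ∀ t, MeasurePreserving (Φ.flow t) μ μ)
    {X : Config N (Fin 3) T3 → ℝ} (hX : Measurable X) {K : ℝ} (hXb : ∀ z, |X z| ≤ K)
    {h : ℝ} (hh : 0 ≤ h) :
    ∫ z, (∫ r in (0 : ℝ)..h, X (Φ.flow r z)) ^ 2 ∂μ =
      2 * ∫ u in (0 : ℝ)..h, (h - u) * ∫ z, X z * X (Φ.flow u z) ∂μ := by
  rw [integral_sq_window_eq_double_of_invariant Φ hμ hmp hX hXb hh]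
  exact double_integral_sub_eq_of_even (f := fun u => ∫ z, X z * X (Φ.flow u z) ∂μ)
    (measurable_integral_mul_flow Φ hμ hX) (abs_integral_mul_flow_le Φ μ hXb)
    (integral_mul_flow_neg_eq Φ hμ hmp hX) hh

/-! ## The registered sub-stub -/

/-- **W6 (`stub_windowFejer`): the window second moment is the Fejér average of the stationary
autocorrelation.** For the homogeneous Gibbs law `G_N = localGibbsLaw σ a u₀ θ N Φ` (`σ ≤ 1/2`, `0 < a`,
`0 < θ`), every hard-sphere flow `Φ`, every bounded measurable `F` and every `h > 0`:
`∫ (h⁻¹∫₀ʰ F(Φ_s z) ds)² dG_N = 2 h⁻² ∫₀ʰ (h − u) (∫ F(z) F(Φ_u z) dG_N) du`. [folklore] -/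
theorem stub_windowFejer :
    ∀ (σ a θ : ℝ) (u₀ : V3), σ ≤ 1 / 2 → 0 < a → 0 < θ → ∀ (N : ℕ)
      (Φ : HardSphereFlow (Torus.geometry (Fin 3)) (hsDiameter σ N) (N + 1))
      (F : Config (N + 1) (Fin 3) T3 → ℝ), Measurable F → (∃ C : ℝ, ∀ z, |F z| ≤ C) →
    ∀ (h : ℝ), 0 < h →
      ∫ z, (h⁻¹ * ∫ s in (0 : ℝ)..h, F (Φ.flow s z)) ^ 2
          ∂(localGibbsLaw σ (fun _ => a) (fun _ => u₀) (fun _ => θ) N Φ) =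
        2 * (h ^ 2)⁻¹ * ∫ u in (0 : ℝ)..h, (h - u) *
          ∫ z, F z * F (Φ.flow u z) ∂(localGibbsLaw σ (fun _ => a) (fun _ => u₀) (fun _ => θ) N Φ) := by
  intro σ a θ u₀ hσ ha hθ N Φ F hFm hFb h hh
  obtain ⟨C, hC⟩ := hFb
  haveI : IsProbabilityMeasure (localGibbsLaw σ (fun _ => a) (fun _ => u₀) (fun _ => θ) N Φ) :=
    isProbabilityMeasure_localGibbsLaw continuous_const continuous_const
      continuous_const (fun _ => ha) (fun _ => hθ) hσ N Φ
  have hsq : ∀ z, (h⁻¹ * ∫ s in (0 : ℝ)..h, F (Φ.flow s z)) ^ 2 =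
      (h ^ 2)⁻¹ * (∫ s in (0 : ℝ)..h, F (Φ.flow s z)) ^ 2 := fun z => by
    rw [mul_pow, inv_pow]
  simp_rw [hsq]
  rw [integral_const_mul, integral_sq_window_eq_fejer_of_invariant Φ (localGibbsLaw_compl_good a θ u₀ Φ)
    (measurePreserving_flow_localGibbsLaw a θ u₀ Φ) hFm hC hh.le]
  ring

end ShearStressHalfDrudeWindowFejer

end Summit.AtomisticToContinuum.HydrodynamicLimit.Theorems

end
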